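/- Fleet lead `ym-wcr-19456-p1` (seat g2), route `WeakCouplingRates`, crux `ColdBoxTwoPointFloorW` (stmt-QuantumFields-19608). -/
-- tree-module: Summits.QuantumFields.YangMills.Theorems.WeakCouplingRatesColdBoxGaussMoments
import Summits.QuantumFields.YangMills.Theorems.WeakCouplingRatesColdBoxOneScaleDefs
import Summits.QuantumFields.YangMills.Theorems.WeakCouplingRatesColdBoxDirichletWick
import Summits.QuantumFields.YangMills.Theorems.WeakCouplingRatesColdBoxPlaqVariance
import Summits.QuantumFields.YangMills.Theorems.WeakCouplingRatesColdBoxColours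
import Literature.Probability.Distributions.GaussianMoments
import Mathlib.MeasureTheory.Function.L2Space

/-!
# Crux `ColdBoxTwoPointFloorW`, stub `stub_boxGaussianDomination`: Gaussian MOMENTS of the quadratic surrogates `qObs` under
# `gauss3 = boxDirichlet^{⊗3}`

The covariance bookkeeping (R6, `abs_cov_tilted_cond_sub_cov_le`) needs square-integrability and second/fourth moment bounds of the
surrogates `qObs H p t = ½ Σ_c (dirCirc H p (t c))²`.  Each `dirCirc H p` is a centred Gaussian under `boxDirichlet H`
(`isGaussianProcess_dirCirc`) with variance `≤ 1` for plaquettes of the enlarged box (`integral_dirCirc_sq_le_one`); hence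
`E[s^{2r}] = v^r(2r−1)!! ≤ (2r−1)!!` (tree `integral_pow_even_gaussianReal`), and by the power-mean inequalities
`(a+b+c)² ≤ 3Σa²`, `(a+b+c)⁴ ≤ 27Σa⁴`:
* `integral_qObs_sq_le` — `∫ qObs² d(gauss3) ≤ 27/4 ≤ 3²`; `memLp_two_qObs`;
* `integral_qObs_mul_qObs_sq_le` — `∫ (qObs p · qObs q)² d(gauss3) ≤ 8505/16 ≤ 24²`; `memLp_two_qObs_mul_qObs`;
* `memLp_two_half_dirCirc_sq` — `½(dirCirc H p)² ∈ L²(boxDirichlet)` (for the colour identity).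
No sorry; no new definition; standard axioms.  NOT a claim about the mass gap.
-/

set_option autoImplicit false

noncomputable section

open MeasureTheory ProbabilityTheory Finset
open scoped Nat NNReal
open Literature.Probability.LatticeModels (Site halfOpenBox)
open Literature.MathematicalPhysics.QuantumLattice
open Literature.MathematicalPhysics.QuantumFieldTheory
open Literature.MathematicalPhysics.QuantumFieldTheory.LatticeMaxwell
open Literature.MathematicalPhysics.QuantumFieldTheory.AxialGauge

namespace Summit.QuantumFields.YangMills.Theorems.WeakCouplingRates

variable {H : ℕ}

/-! ## Even moments of one Dirichlet circulation -/

/-- **Even moments of a Dirichlet circulation**: if `E_D[s(p)²] ≤ 1` then `E_D[s(p)^{2r}] ≤ (2r−1)!!` and `s(p)^{2r}` is integrable. -/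
theorem integral_dirCirc_pow_even_le (p : Plaq 4) (hvar : ∫ s, dirCirc H p s ^ 2 ∂(boxDirichlet H) ≤ 1) (r : ℕ) :
    Integrable (fun s => dirCirc H p s ^ (2 * r)) (boxDirichlet H) ∧
      ∫ s, dirCirc H p s ^ (2 * r) ∂(boxDirichlet H) ≤ ((2 * r - 1 : ℕ)‼ : ℝ) := by
  have hG : HasGaussianLaw (dirCirc H p) (boxDirichlet H) := (isGaussianProcess_dirCirc H).hasGaussianLaw_eval p
  have hmap := hG.map_eq_gaussianReal
  rw [integral_dirCirc] at hmap
  set v : ℝ≥0 := (Var[dirCirc H p; boxDirichlet H]).toNNReal with hv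
  have hXm : AEMeasurable (dirCirc H p) (boxDirichlet H) := (measurable_dirCirc p).aemeasurable
  have hpowm : AEStronglyMeasurable (fun x : ℝ => x ^ (2 * r)) ((boxDirichlet H).map (dirCirc H p)) :=
    (measurable_id.pow_const _).aestronglyMeasurable
  -- integrability transported from the Gaussian
  have hint : Integrable (fun s => dirCirc H p s ^ (2 * r)) (boxDirichlet H) := by
    have h1 : Integrable (fun x : ℝ => x ^ (2 * r)) ((boxDirichlet H).map (dirCirc H p)) := by
      rw [hmap]; exact Literature.Probability.Distributions.integrable_pow_gaussianReal 0 v (2 * r)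
    exact (integrable_map_measure hpowm hXm).1 h1
  refine ⟨hint, ?_⟩
  -- the variance is `∫ s(p)² ≤ 1`
  have hvar' : (v : ℝ) ≤ 1 := by
    have hV : Var[dirCirc H p; boxDirichlet H] = ∫ s, dirCirc H p s ^ 2 ∂(boxDirichlet H) :=
      variance_of_integral_eq_zero hXm (integral_dirCirc p)
    rw [hv, Real.coe_toNNReal _ (variance_nonneg _ _), hV]
    exact hvar
  calc ∫ s, dirCirc H p s ^ (2 * r) ∂(boxDirichlet H) = ∫ x, x ^ (2 * r) ∂((boxDirichlet H).map (dirCirc H p)) :=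
        (integral_map hXm hpowm).symm
    _ = (v : ℝ) ^ r * ((2 * r - 1 : ℕ)‼ : ℝ) := by
        rw [hmap]; exact Literature.Probability.Distributions.integral_pow_even_gaussianReal v r
    _ ≤ 1 ^ r * ((2 * r - 1 : ℕ)‼ : ℝ) := by gcongr
    _ = _ := by rw [one_pow, one_mul]

/-- Plaquettes touching the cold box have Dirichlet variance `≤ 1`. -/
theorem integral_dirCirc_sq_le_one_of_touching {p : ZdPlaquette 4} (hp : p ∈ plaquettesTouching (boxEdges 4 (2 * H + 1))) :
    ∫ s, dirCirc H (p.1, p.2.1.1, p.2.1.2) s ^ 2 ∂(boxDirichlet H) ≤ 1 := by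
  have h := integral_dirCirc_sq_le_one (H := H) _ (unshift_mem_plaquettesIn hp)
  rwa [shift_unshift_dirCorner] at h

/-! ## Power-mean inequalities for three terms -/

/-- `(a + b + c)² ≤ 3(a² + b² + c²)`. -/
theorem sq_sum_three_le (a b c : ℝ) : (a + b + c) ^ 2 ≤ 3 * (a ^ 2 + b ^ 2 + c ^ 2) := by
  nlinarith [sq_nonneg (a - b), sq_nonneg (b - c), sq_nonneg (a - c)]

/-- `(a + b + c)⁴ ≤ 27(a⁴ + b⁴ + c⁴)`. -/
theorem pow_four_sum_three_le (a b c : ℝ) : (a + b + c) ^ 4 ≤ 27 * (a ^ 4 + b ^ 4 + c ^ 4) := by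
  have h1 := sq_sum_three_le a b c
  have h2 := sq_sum_three_le (a ^ 2) (b ^ 2) (c ^ 2)
  have h0 : 0 ≤ (a + b + c) ^ 2 := sq_nonneg _
  calc (a + b + c) ^ 4 = ((a + b + c) ^ 2) ^ 2 := by ring
    _ ≤ (3 * (a ^ 2 + b ^ 2 + c ^ 2)) ^ 2 := pow_le_pow_left₀ h0 h1 2
    _ = 9 * (a ^ 2 + b ^ 2 + c ^ 2) ^ 2 := by ring
    _ ≤ 9 * (3 * ((a ^ 2) ^ 2 + (b ^ 2) ^ 2 + (c ^ 2) ^ 2)) := by nlinarith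
    _ = 27 * (a ^ 4 + b ^ 4 + c ^ 4) := by ring

/-! ## Moments of the surrogates under `gauss3` -/

/-- Colour marginals: `∫ f(t c) d(gauss3) = ∫ f d(boxDirichlet)` and integrability transfers. -/
theorem integral_comp_eval_gauss3 (f : EuclideanSpace ℝ (DirFree H) → ℝ) (c : Fin 3) :
    ∫ t, f (t c) ∂(gauss3 H) = ∫ s, f s ∂(boxDirichlet H) := by
  unfold gauss3; exact integral_pi_eval _ f c

/-- Integrability of a colour marginal. -/
theorem integrable_comp_eval_gauss3 {f : EuclideanSpace ℝ (DirFree H) → ℝ} (hfm : Measurable f)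
    (hf : Integrable f (boxDirichlet H)) (c : Fin 3) : Integrable (fun t : TSpace H => f (t c)) (gauss3 H) := by
  have hmp : MeasurePreserving (fun t : TSpace H => t c) (gauss3 H) (boxDirichlet H) := by
    unfold gauss3; exact measurePreserving_eval _ c
  have h := (integrable_map_measure (μ := gauss3 H) (f := fun t : TSpace H => t c) (g := f)
    (by rw [hmp.map_eq]; exact hfm.aestronglyMeasurable) (measurable_pi_apply c).aemeasurable).1 (by rw [hmp.map_eq]; exact hf)
  exact h

/-- Pointwise: `qObs² ≤ ¾ Σ_c s_c⁴`. -/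
theorem qObs_sq_le (p : Plaq 4) (t : TSpace H) : qObs H p t ^ 2 ≤ 3 / 4 * ∑ c, dirCirc H p (t c) ^ 4 := by
  rw [qObs, Fin.sum_univ_three, Fin.sum_univ_three]
  have h := sq_sum_three_le (dirCirc H p (t 0) ^ 2) (dirCirc H p (t 1) ^ 2) (dirCirc H p (t 2) ^ 2)
  nlinarith

/-- Pointwise: `qObs⁴ ≤ (27/16) Σ_c s_c⁸`. -/
theorem qObs_pow_four_le (p : Plaq 4) (t : TSpace H) : qObs H p t ^ 4 ≤ 27 / 16 * ∑ c, dirCirc H p (t c) ^ 8 := by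
  rw [qObs, Fin.sum_univ_three, Fin.sum_univ_three]
  have h := pow_four_sum_three_le (dirCirc H p (t 0) ^ 2) (dirCirc H p (t 1) ^ 2) (dirCirc H p (t 2) ^ 2)
  have e : ∀ x : ℝ, (x ^ 2) ^ 4 = x ^ 8 := fun x => by ring
  rw [e, e, e] at h
  have e2 : (1 / 2 * (dirCirc H p (t 0) ^ 2 + dirCirc H p (t 1) ^ 2 + dirCirc H p (t 2) ^ 2)) ^ 4 =
      1 / 16 * (dirCirc H p (t 0) ^ 2 + dirCirc H p (t 1) ^ 2 + dirCirc H p (t 2) ^ 2) ^ 4 := by ring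
  rw [e2]
  linarith

/-- Integrability of `Σ_c s_c^{2r}` under `gauss3` and its integral bound `3·(2r−1)!!`. -/
theorem integral_sum_dirCirc_pow_even_le (p : Plaq 4) (hvar : ∫ s, dirCirc H p s ^ 2 ∂(boxDirichlet H) ≤ 1) (r : ℕ) :
    Integrable (fun t : TSpace H => ∑ c, dirCirc H p (t c) ^ (2 * r)) (gauss3 H) ∧
      ∫ t, ∑ c, dirCirc H p (t c) ^ (2 * r) ∂(gauss3 H) ≤ 3 * ((2 * r - 1 : ℕ)‼ : ℝ) := by
  obtain ⟨hint, hle⟩ := integral_dirCirc_pow_even_le p hvar r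
  have hc : ∀ c : Fin 3, Integrable (fun t : TSpace H => dirCirc H p (t c) ^ (2 * r)) (gauss3 H) := fun c =>
    integrable_comp_eval_gauss3 ((measurable_dirCirc p).pow_const _) hint c
  refine ⟨integrable_finsetSum _ fun c _ => hc c, ?_⟩
  rw [integral_finsetSum _ fun c _ => hc c]
  calc ∑ c : Fin 3, ∫ t, dirCirc H p (t c) ^ (2 * r) ∂(gauss3 H) = ∑ _c : Fin 3, ∫ s, dirCirc H p s ^ (2 * r) ∂(boxDirichlet H) :=
        Finset.sum_congr rfl fun c _ => integral_comp_eval_gauss3 (fun s => dirCirc H p s ^ (2 * r)) c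
    _ ≤ ∑ _c : Fin 3, ((2 * r - 1 : ℕ)‼ : ℝ) := Finset.sum_le_sum fun c _ => hle
    _ = _ := by rw [Finset.sum_const, Finset.card_univ, Fintype.card_fin, nsmul_eq_mul]; norm_num

/-- **Second moment of the surrogate**: `∫ qObs² d(gauss3) ≤ 3²` and `qObs ∈ L²(gauss3)`, for `E_D[s(p)²] ≤ 1`. -/
theorem memLp_two_qObs (p : Plaq 4) (hvar : ∫ s, dirCirc H p s ^ 2 ∂(boxDirichlet H) ≤ 1) :
    MemLp (qObs H p) 2 (gauss3 H) ∧ ∫ t, qObs H p t ^ 2 ∂(gauss3 H) ≤ 3 ^ 2 := by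
  obtain ⟨hint4, hle4⟩ := integral_sum_dirCirc_pow_even_le p hvar 2
  have hdom : Integrable (fun t : TSpace H => 3 / 4 * ∑ c, dirCirc H p (t c) ^ 4) (gauss3 H) := hint4.const_mul _
  have hsq : Integrable (fun t => qObs H p t ^ 2) (gauss3 H) :=
    hdom.mono' (((measurable_qObs p).pow_const 2).aestronglyMeasurable) (ae_of_all _ fun t => by
      rw [Real.norm_eq_abs, abs_of_nonneg (sq_nonneg _)]; exact qObs_sq_le p t)
  refine ⟨(memLp_two_iff_integrable_sq (measurable_qObs p).aestronglyMeasurable).2 hsq, ?_⟩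
  calc ∫ t, qObs H p t ^ 2 ∂(gauss3 H) ≤ ∫ t, 3 / 4 * ∑ c, dirCirc H p (t c) ^ 4 ∂(gauss3 H) :=
        integral_mono hsq hdom fun t => qObs_sq_le p t
    _ = 3 / 4 * ∫ t, ∑ c, dirCirc H p (t c) ^ 4 ∂(gauss3 H) := integral_const_mul _ _
    _ ≤ 3 / 4 * (3 * ((2 * 2 - 1 : ℕ)‼ : ℝ)) := by gcongr
    _ ≤ 3 ^ 2 := by norm_num [Nat.doubleFactorial]

/-- **Second moment of a product of surrogates**: `∫ (qObs p · qObs q)² d(gauss3) ≤ 24²` and `qObs p · qObs q ∈ L²(gauss3)`. -/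
theorem memLp_two_qObs_mul_qObs (p q : Plaq 4) (hp : ∫ s, dirCirc H p s ^ 2 ∂(boxDirichlet H) ≤ 1)
    (hq : ∫ s, dirCirc H q s ^ 2 ∂(boxDirichlet H) ≤ 1) :
    MemLp (fun t => qObs H p t * qObs H q t) 2 (gauss3 H) ∧ ∫ t, (qObs H p t * qObs H q t) ^ 2 ∂(gauss3 H) ≤ 24 ^ 2 := by
  obtain ⟨hint8p, hle8p⟩ := integral_sum_dirCirc_pow_even_le p hp 4
  obtain ⟨hint8q, hle8q⟩ := integral_sum_dirCirc_pow_even_le q hq 4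
  set D : TSpace H → ℝ := fun t => 27 / 32 * (∑ c, dirCirc H p (t c) ^ 8 + ∑ c, dirCirc H q (t c) ^ 8) with hD
  have hdom : Integrable D (gauss3 H) := (hint8p.add hint8q).const_mul _
  have hpt : ∀ t, (qObs H p t * qObs H q t) ^ 2 ≤ D t := fun t => by
    have h1 := qObs_pow_four_le p t
    have h2 := qObs_pow_four_le q t
    have hamgm : (qObs H p t * qObs H q t) ^ 2 ≤ (qObs H p t ^ 4 + qObs H q t ^ 4) / 2 := by
      nlinarith [sq_nonneg (qObs H p t ^ 2 - qObs H q t ^ 2)]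
    simp only [hD]
    linarith
  have hmeas : Measurable fun t => qObs H p t * qObs H q t := (measurable_qObs p).mul (measurable_qObs q)
  have hsq : Integrable (fun t => (qObs H p t * qObs H q t) ^ 2) (gauss3 H) :=
    hdom.mono' ((hmeas.pow_const 2).aestronglyMeasurable) (ae_of_all _ fun t => by
      rw [Real.norm_eq_abs, abs_of_nonneg (sq_nonneg _)]; exact hpt t)
  refine ⟨(memLp_two_iff_integrable_sq hmeas.aestronglyMeasurable).2 hsq, ?_⟩
  calc ∫ t, (qObs H p t * qObs H q t) ^ 2 ∂(gauss3 H) ≤ ∫ t, D t ∂(gauss3 H) := integral_mono hsq hdom hpt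
    _ = 27 / 32 * ((∫ t, ∑ c, dirCirc H p (t c) ^ 8 ∂(gauss3 H)) + ∫ t, ∑ c, dirCirc H q (t c) ^ 8 ∂(gauss3 H)) := by
        simp only [hD]; rw [integral_const_mul, integral_add hint8p hint8q]
    _ ≤ 27 / 32 * (3 * ((2 * 4 - 1 : ℕ)‼ : ℝ) + 3 * ((2 * 4 - 1 : ℕ)‼ : ℝ)) := by gcongr
    _ ≤ 24 ^ 2 := by norm_num [Nat.doubleFactorial]

/-- `½ s(p)² ∈ L²(boxDirichlet)` when `E_D[s(p)²] ≤ 1` (input of the colour identity `cov_colourSum_pi`). -/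
theorem memLp_two_half_dirCirc_sq (p : Plaq 4) (hvar : ∫ s, dirCirc H p s ^ 2 ∂(boxDirichlet H) ≤ 1) :
    MemLp (fun s => 1 / 2 * dirCirc H p s ^ 2) 2 (boxDirichlet H) := by
  obtain ⟨hint4, -⟩ := integral_dirCirc_pow_even_le p hvar 2
  have hmeas : Measurable fun s => 1 / 2 * dirCirc H p s ^ 2 := measurable_const.mul ((measurable_dirCirc p).pow_const 2)
  refine (memLp_two_iff_integrable_sq hmeas.aestronglyMeasurable).2 ?_
  refine (hint4.const_mul (1 / 4)).mono' ((hmeas.pow_const 2).aestronglyMeasurable) (ae_of_all _ fun s => ?_)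
  rw [Real.norm_eq_abs, abs_of_nonneg (sq_nonneg _)]
  have : (1 / 2 * dirCirc H p s ^ 2) ^ 2 = 1 / 4 * dirCirc H p s ^ (2 * 2) := by ring
  rw [this]

end Summit.QuantumFields.YangMills.Theorems.WeakCouplingRates

end
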